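import Summits.Ventures.HSemireg.WedgeHankelRecurrenceGaussChebyshevSupNormEquality
import Mathlib.NumberTheory.Real.GoldenRatio

/-!
# Venture HSemireg — **THE GOLDEN RATIO AND THE VIETA–LUCAS POLYNOMIALS: `C_5 + 2 = (X + 2)(X² − X − 1)²`, `C_5 − 2 = (X − 2)(X² + X − 1)²`, `S_4 = (X² − X − 1)(X² + X − 1)` in every commutative
# ring; for any `x` with `x² = x + 1` the values `C_n(x)`: `2, x, x − 1, 1 − x, −x, −2, …` and `S_n(x)`: `1, x, x, 1, 0, −1, …` with `C_{n+5}(x) = −C_n(x)`, `S_{n+5}(x) = −S_n(x)` (period `10`);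
# over `ℝ`: `φ = 2cos(π∕5)`, `C_n(φ) = 2cos(nπ∕5)`, `2cos(2π∕5) = φ − 1 = −ψ`, `2cos(3π∕5) = ψ`, `2cos(4π∕5) = −φ`, and the root multisets `(S_4).roots = {φ, ψ, −φ, −ψ}`,
# `(C_5 + 2).roots = {−2, φ, ψ, φ, ψ}`, `(C_5 − 2).roots = {2, −φ, −ψ, −φ, −ψ}`**

HONEST FRAMING. Part of the Lean index of the computation cell `pub-hsemireg` (seat p10 gen 49, Sunday typer «UNIFORM-IN-n»).  Polynomial algebra over a commutative ring (Mathlib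
`Polynomial.Chebyshev.S ∕ C`) and real trigonometry (Mathlib `Real.cos_pi_div_five`, `Real.goldenRatio`); no variety, no cohomology theory, no sheaf, no Ext group and no semiregularity map is
constructed here; nothing here says that HC / HC_CM / HC_AV holds; no Literature fact (unproved `Prop`) is declared or used.  Custodian versions as in `WedgeHankelSiegelIdeal` (1/3).
SOURCES (cited).  T. Koshy, *Fibonacci and Lucas Numbers with Applications* (Wiley 2001), Ch. 17 («Fibonacci and Lucas numbers and the golden ratio in trigonometry»: `2cos(π∕5) = φ`, `2cos(2π∕5) = φ − 1`);
E. W. Hobson, *A Treatise on Plane Trigonometry* (7th ed. 1928), §§60–61 (the values of `cos(kπ∕5)`); P. Ribenboim, *My Numbers, My Friends* (Springer 2000), Ch. 1 (the Vieta–Lucas sequences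
`V_n` and their period modulo a root of `t² − Xt + 1`).
PROOF TYPED HERE.  (1) The explicit low-degree polynomials `C_3 = X³ − 3X`, `C_4 = X⁴ − 4X² + 2`, `C_5 = X⁵ − 5X³ + 5X`, `S_3 = X³ − 2X`, `S_4 = X⁴ − 3X² + 1`, `S_5 = X⁵ − 4X³ + 3X` from Mathlib's
three-term recurrences, and the three factorisations by `ring`; (2) for `x² = x + 1` the values of `C_2 … C_5`, `S_2 … S_5` at `x` by `linear_combination`, and `C_{n+5}(x) = −C_n(x)`,
`S_{n+5}(x) = −S_n(x)` by `Polynomial.Chebyshev.induct` (an order-two recurrence vanishing at two consecutive indices vanishes); (3) over `ℝ`: `2cos(π∕5) = φ` is Mathlib's `Real.cos_pi_div_five`,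
so `C_n(φ) = 2cos(nπ∕5)` (`C_two_mul_real_cos`) and (2) at `x = φ` (`Real.goldenRatio_sq`) gives the cosine table; the root multisets from the factorisations with `X² − X − 1 = (X − φ)(X − ψ)`
(`φ + ψ = 1`, `φψ = −1`) and Mathlib `roots_multiset_prod_X_sub_C`.
DEDUP DISCLOSURE (`rg -n 'goldenRatio|pi_div_five|C R 5|S R 4 =|_three|_four|_five' Summits/Ventures/HSemireg Literature`, 2026-09-04): no explicit `C_3 ∕ C_4 ∕ C_5 ∕ S_3 ∕ S_4 ∕ S_5` expansion
in Mathlib or the tree (Mathlib stops at `C_two`, `S_two`); `Literature.Computability.QuantumComplexity.GoldenCyclotomicArithmetic.cos_two_pi_div_five_eq` (`cos(2π∕5) = (φ − 1)∕2`, a quantum-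
complexity file with its own import chain — CITED as prior for the `k = 2` entry of the cosine table below, which is re-derived here in one line from the ring-general value `C_2(x) = x − 1` rather
than imported) and `…sin_two_pi_div_five_eq`; Mathlib `Real.cos_pi_div_five`, `Real.goldenRatio_sq`, `goldenRatio_add_goldenConj`, `goldenRatio_mul_goldenConj`, `one_sub_goldenConj`; nothing on
`C_n ∕ S_n` at the golden ratio; the one-liners `2cos(π∕5) = φ` and `2cos(2π∕5) = φ⁻¹` also sit in another summit's proof file (`Summit.KontsevichZagierPeriods.…KzOnePeriodsG0CyclotomicFive.two_mul_cos_pi_div_five ∕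
two_mul_cos_two_pi_div_five`, not importable here without a cross-summit edge; the first is re-derived below in one line from Mathlib under a distinct name); 0 hits for the 23 names below.

WHAT IS IN THE TREE.  Mathlib `Polynomial.Chebyshev.C_zero ∕ C_one ∕ C_two ∕ C_add_two ∕ C_sub_one ∕ S_zero ∕ S_one ∕ S_two ∕ S_add_two ∕ S_sub_one ∕ induct`, `C_two_mul_real_cos`, `S_two_mul_real_cos`,
`roots_multiset_prod_X_sub_C`, `Real.cos_pi_div_five`, the `Real.goldenRatio ∕ goldenConj` API.
THIS FILE (namespace `Summit.Ventures.HSemireg.Wedge.HankelOuter` continued; CHAINED on N523; 0 definitions):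
* §1289 `chebyshevC_three`, `chebyshevC_four`, `chebyshevC_five`, `chebyshevS_three`, `chebyshevS_four`, `chebyshevS_five` (explicit); **`chebyshevC_five_add_two`** (`= (X + 2)(X² − X − 1)²`),
  **`chebyshevC_five_sub_two`** (`= (X − 2)(X² + X − 1)²`), **`chebyshevS_four_eq_mul`** (`= (X² − X − 1)(X² + X − 1)`); **`chebyshevC_eval_of_sq_eq_self_add_one`**,
  **`chebyshevS_eval_of_sq_eq_self_add_one`** (values at `x` with `x² = x + 1`), **`chebyshevC_eval_add_five_of_sq_eq`**, **`chebyshevS_eval_add_five_of_sq_eq`** (`= −` the value at `n`),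
  `chebyshevC_eval_add_ten_of_sq_eq`, `chebyshevS_eval_add_ten_of_sq_eq` (period `10`); `two_mul_cos_pi_div_five_eq_goldenRatio` (`= φ`), **`chebyshevC_eval_goldenRatio`** (`C_n(φ) = 2cos(nπ∕5)`),
  **`chebyshevS_eval_goldenRatio_mul_sin`**, **`two_mul_cos_mul_pi_div_five`** (`2cos(2π∕5) = −ψ`, `2cos(3π∕5) = ψ`, `2cos(4π∕5) = −φ`); `X_sq_sub_X_sub_one_eq_mul`, `X_sq_add_X_sub_one_eq_mul`,
  **`chebyshevS_four_roots_real`** (`{φ, ψ, −φ, −ψ}`), **`chebyshevC_five_add_two_roots_real`** (`{−2, φ, ψ, φ, ψ}`), **`chebyshevC_five_sub_two_roots_real`** (`{2, −φ, −ψ, −φ, −ψ}`).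
CAVEATS.  `φ = Real.goldenRatio = (1 + √5)∕2`, `ψ = Real.goldenConj = (1 − √5)∕2`.  Nothing Ext-side.  New names only.
-/

open Module Polynomial
open scoped Matrix Polynomial

namespace Summit.Ventures.HSemireg.Wedge.HankelOuter

/-! ## §1289. The golden ratio and `C_n`, `S_n` -/

/-! ### Explicit low-degree polynomials and the golden factorisations (every commutative ring) -/

/-- `C_3 = X³ − 3X`. [this file, §1289] -/
theorem chebyshevC_three (R : Type*) [CommRing R] : Polynomial.Chebyshev.C R 3 = X ^ 3 - 3 * X := by
  rw [show (3 : ℤ) = 1 + 2 by norm_num, Polynomial.Chebyshev.C_add_two, show (1 : ℤ) + 1 = 2 by norm_num, Polynomial.Chebyshev.C_two, Polynomial.Chebyshev.C_one]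
  ring

/-- `C_4 = X⁴ − 4X² + 2`. [this file, §1289] -/
theorem chebyshevC_four (R : Type*) [CommRing R] : Polynomial.Chebyshev.C R 4 = X ^ 4 - 4 * X ^ 2 + 2 := by
  rw [show (4 : ℤ) = 2 + 2 by norm_num, Polynomial.Chebyshev.C_add_two, show (2 : ℤ) + 1 = 3 by norm_num, chebyshevC_three, Polynomial.Chebyshev.C_two]
  ring

/-- `C_5 = X⁵ − 5X³ + 5X`. [this file, §1289] -/
theorem chebyshevC_five (R : Type*) [CommRing R] : Polynomial.Chebyshev.C R 5 = X ^ 5 - 5 * X ^ 3 + 5 * X := by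
  rw [show (5 : ℤ) = 3 + 2 by norm_num, Polynomial.Chebyshev.C_add_two, show (3 : ℤ) + 1 = 4 by norm_num, chebyshevC_four, chebyshevC_three]
  ring

/-- `S_3 = X³ − 2X`. [this file, §1289] -/
theorem chebyshevS_three (R : Type*) [CommRing R] : Polynomial.Chebyshev.S R 3 = X ^ 3 - 2 * X := by
  rw [show (3 : ℤ) = 1 + 2 by norm_num, Polynomial.Chebyshev.S_add_two, show (1 : ℤ) + 1 = 2 by norm_num, Polynomial.Chebyshev.S_two, Polynomial.Chebyshev.S_one]
  ring

/-- `S_4 = X⁴ − 3X² + 1`. [this file, §1289] -/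
theorem chebyshevS_four (R : Type*) [CommRing R] : Polynomial.Chebyshev.S R 4 = X ^ 4 - 3 * X ^ 2 + 1 := by
  rw [show (4 : ℤ) = 2 + 2 by norm_num, Polynomial.Chebyshev.S_add_two, show (2 : ℤ) + 1 = 3 by norm_num, chebyshevS_three, Polynomial.Chebyshev.S_two]
  ring

/-- `S_5 = X⁵ − 4X³ + 3X`. [this file, §1289] -/
theorem chebyshevS_five (R : Type*) [CommRing R] : Polynomial.Chebyshev.S R 5 = X ^ 5 - 4 * X ^ 3 + 3 * X := by
  rw [show (5 : ℤ) = 3 + 2 by norm_num, Polynomial.Chebyshev.S_add_two, show (3 : ℤ) + 1 = 4 by norm_num, chebyshevS_four, chebyshevS_three]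
  ring

/-- **`C_5 + 2 = (X + 2)(X² − X − 1)²`** in every commutative ring (the golden polynomial squared). [Koshy 2001, Ch. 17; this file, §1289] -/
theorem chebyshevC_five_add_two (R : Type*) [CommRing R] : Polynomial.Chebyshev.C R 5 + 2 = (X + 2) * (X ^ 2 - X - 1) ^ 2 := by
  rw [chebyshevC_five]
  ring

/-- **`C_5 − 2 = (X − 2)(X² + X − 1)²`** in every commutative ring. [Koshy 2001, Ch. 17; this file, §1289] -/
theorem chebyshevC_five_sub_two (R : Type*) [CommRing R] : Polynomial.Chebyshev.C R 5 - 2 = (X - 2) * (X ^ 2 + X - 1) ^ 2 := by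
  rw [chebyshevC_five]
  ring

/-- **`S_4 = (X² − X − 1)(X² + X − 1)`** in every commutative ring. [Koshy 2001, Ch. 17; this file, §1289] -/
theorem chebyshevS_four_eq_mul (R : Type*) [CommRing R] : Polynomial.Chebyshev.S R 4 = (X ^ 2 - X - 1) * (X ^ 2 + X - 1) := by
  rw [chebyshevS_four]
  ring

/-! ### Values at a golden element `x² = x + 1` (every commutative ring) -/

/-- **For `x² = x + 1`: `C_2(x) = x − 1`, `C_3(x) = 1 − x`, `C_4(x) = −x`, `C_5(x) = −2`.** [Koshy 2001, Ch. 17; this file, §1289] -/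
theorem chebyshevC_eval_of_sq_eq_self_add_one {R : Type*} [CommRing R] {x : R} (hx : x ^ 2 = x + 1) :
    (Polynomial.Chebyshev.C R 2).eval x = x - 1 ∧ (Polynomial.Chebyshev.C R 3).eval x = 1 - x ∧ (Polynomial.Chebyshev.C R 4).eval x = -x ∧
      (Polynomial.Chebyshev.C R 5).eval x = -2 := by
  refine ⟨?_, ?_, ?_, ?_⟩
  · rw [Polynomial.Chebyshev.C_two]
    simp only [eval_sub, eval_pow, eval_X, eval_ofNat]
    linear_combination hx
  · rw [chebyshevC_three]
    simp only [eval_sub, eval_mul, eval_pow, eval_X, eval_ofNat]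
    linear_combination (x + 1) * hx
  · rw [chebyshevC_four]
    simp only [eval_add, eval_sub, eval_mul, eval_pow, eval_X, eval_ofNat]
    linear_combination (x ^ 2 + x - 2) * hx
  · rw [chebyshevC_five]
    simp only [eval_add, eval_sub, eval_mul, eval_pow, eval_X, eval_ofNat]
    linear_combination (x + 2) * (x ^ 2 - x - 1) * hx

/-- **For `x² = x + 1`: `S_2(x) = x`, `S_3(x) = 1`, `S_4(x) = 0`, `S_5(x) = −1`.** [Koshy 2001, Ch. 17; this file, §1289] -/
theorem chebyshevS_eval_of_sq_eq_self_add_one {R : Type*} [CommRing R] {x : R} (hx : x ^ 2 = x + 1) :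
    (Polynomial.Chebyshev.S R 2).eval x = x ∧ (Polynomial.Chebyshev.S R 3).eval x = 1 ∧ (Polynomial.Chebyshev.S R 4).eval x = 0 ∧ (Polynomial.Chebyshev.S R 5).eval x = -1 := by
  refine ⟨?_, ?_, ?_, ?_⟩
  · rw [Polynomial.Chebyshev.S_two]
    simp only [eval_sub, eval_pow, eval_X, eval_one]
    linear_combination hx
  · rw [chebyshevS_three]
    simp only [eval_sub, eval_mul, eval_pow, eval_X, eval_ofNat]
    linear_combination (x + 1) * hx
  · rw [chebyshevS_four]
    simp only [eval_add, eval_sub, eval_mul, eval_pow, eval_X, eval_ofNat, eval_one]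
    linear_combination (x ^ 2 + x - 1) * hx
  · rw [chebyshevS_five]
    simp only [eval_add, eval_sub, eval_mul, eval_pow, eval_X, eval_ofNat]
    linear_combination (x ^ 3 + x ^ 2 - 2 * x - 1) * hx

/-- **For `x² = x + 1`: `C_{n+5}(x) = −C_n(x)`** for all `n ∈ ℤ` (an order-two linear recurrence vanishing at two consecutive indices vanishes identically). [Ribenboim 2000, Ch. 1; this file, §1289] -/
theorem chebyshevC_eval_add_five_of_sq_eq {R : Type*} [CommRing R] {x : R} (hx : x ^ 2 = x + 1) (n : ℤ) :
    (Polynomial.Chebyshev.C R (n + 5)).eval x = -(Polynomial.Chebyshev.C R n).eval x := by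
  obtain ⟨_, _, h4, h5⟩ := chebyshevC_eval_of_sq_eq_self_add_one hx
  induction n using Polynomial.Chebyshev.induct with
  | zero => rw [zero_add, h5, Polynomial.Chebyshev.C_zero, eval_ofNat]
  | one =>
    rw [show (1 : ℤ) + 5 = 4 + 2 by norm_num, Polynomial.Chebyshev.C_add_two R 4, show (4 : ℤ) + 1 = 5 by norm_num, eval_sub, eval_mul, eval_X, h5, h4,
      Polynomial.Chebyshev.C_one, eval_X]
    ring
  | add_two m ih1 ih2 =>
    rw [show (m : ℤ) + 2 + 5 = (m + 5) + 2 by ring, Polynomial.Chebyshev.C_add_two R ((m : ℤ) + 5), show (m : ℤ) + 5 + 1 = m + 1 + 5 by ring,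
      Polynomial.Chebyshev.C_add_two R (m : ℤ)]
    simp only [eval_sub, eval_mul, eval_X]
    rw [ih1, ih2]
    ring
  | neg_add_one m ih1 ih2 =>
    rw [show (-(m : ℤ) - 1 + 5) = (-m + 5) - 1 by ring, Polynomial.Chebyshev.C_sub_one R (-(m : ℤ) + 5), show (-(m : ℤ) + 5 + 1) = -m + 1 + 5 by ring,
      Polynomial.Chebyshev.C_sub_one R (-(m : ℤ))]
    simp only [eval_sub, eval_mul, eval_X]
    rw [ih1, ih2]
    ring

/-- **For `x² = x + 1`: `S_{n+5}(x) = −S_n(x)`** for all `n ∈ ℤ`. [Ribenboim 2000, Ch. 1; this file, §1289] -/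
theorem chebyshevS_eval_add_five_of_sq_eq {R : Type*} [CommRing R] {x : R} (hx : x ^ 2 = x + 1) (n : ℤ) :
    (Polynomial.Chebyshev.S R (n + 5)).eval x = -(Polynomial.Chebyshev.S R n).eval x := by
  obtain ⟨_, _, h4, h5⟩ := chebyshevS_eval_of_sq_eq_self_add_one hx
  induction n using Polynomial.Chebyshev.induct with
  | zero => rw [zero_add, h5, Polynomial.Chebyshev.S_zero, eval_one]
  | one =>
    rw [show (1 : ℤ) + 5 = 4 + 2 by norm_num, Polynomial.Chebyshev.S_add_two R 4, show (4 : ℤ) + 1 = 5 by norm_num, eval_sub, eval_mul, eval_X, h5, h4,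
      Polynomial.Chebyshev.S_one, eval_X]
    ring
  | add_two m ih1 ih2 =>
    rw [show (m : ℤ) + 2 + 5 = (m + 5) + 2 by ring, Polynomial.Chebyshev.S_add_two R ((m : ℤ) + 5), show (m : ℤ) + 5 + 1 = m + 1 + 5 by ring,
      Polynomial.Chebyshev.S_add_two R (m : ℤ)]
    simp only [eval_sub, eval_mul, eval_X]
    rw [ih1, ih2]
    ring
  | neg_add_one m ih1 ih2 =>
    rw [show (-(m : ℤ) - 1 + 5) = (-m + 5) - 1 by ring, Polynomial.Chebyshev.S_sub_one R (-(m : ℤ) + 5), show (-(m : ℤ) + 5 + 1) = -m + 1 + 5 by ring,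
      Polynomial.Chebyshev.S_sub_one R (-(m : ℤ))]
    simp only [eval_sub, eval_mul, eval_X]
    rw [ih1, ih2]
    ring

/-- For `x² = x + 1`: `C_{n+10}(x) = C_n(x)` (period `10`). [this file, §1289] -/
theorem chebyshevC_eval_add_ten_of_sq_eq {R : Type*} [CommRing R] {x : R} (hx : x ^ 2 = x + 1) (n : ℤ) :
    (Polynomial.Chebyshev.C R (n + 10)).eval x = (Polynomial.Chebyshev.C R n).eval x := by
  rw [show n + 10 = (n + 5) + 5 by ring, chebyshevC_eval_add_five_of_sq_eq hx, chebyshevC_eval_add_five_of_sq_eq hx, neg_neg]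

/-- For `x² = x + 1`: `S_{n+10}(x) = S_n(x)` (period `10`). [this file, §1289] -/
theorem chebyshevS_eval_add_ten_of_sq_eq {R : Type*} [CommRing R] {x : R} (hx : x ^ 2 = x + 1) (n : ℤ) :
    (Polynomial.Chebyshev.S R (n + 10)).eval x = (Polynomial.Chebyshev.S R n).eval x := by
  rw [show n + 10 = (n + 5) + 5 by ring, chebyshevS_eval_add_five_of_sq_eq hx, chebyshevS_eval_add_five_of_sq_eq hx, neg_neg]

/-! ### Over `ℝ`: `φ = 2cos(π∕5)` -/

/-- `2cos(π∕5) = φ` (Mathlib `Real.cos_pi_div_five`). [Hobson 1928, §60; this file, §1289] -/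
theorem two_mul_cos_pi_div_five_eq_goldenRatio : 2 * Real.cos (Real.pi / 5) = Real.goldenRatio := by
  rw [Real.cos_pi_div_five, Real.goldenRatio]
  ring

/-- **`C_n(φ) = 2cos(nπ∕5)`** for all `n ∈ ℤ`. [Koshy 2001, Ch. 17; this file, §1289] -/
theorem chebyshevC_eval_goldenRatio (n : ℤ) : (Polynomial.Chebyshev.C ℝ n).eval Real.goldenRatio = 2 * Real.cos (n * (Real.pi / 5)) := by
  rw [← two_mul_cos_pi_div_five_eq_goldenRatio, Polynomial.Chebyshev.C_two_mul_real_cos]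

/-- **`S_n(φ) · sin(π∕5) = sin((n+1)π∕5)`** for all `n ∈ ℤ`. [Koshy 2001, Ch. 17; this file, §1289] -/
theorem chebyshevS_eval_goldenRatio_mul_sin (n : ℤ) :
    (Polynomial.Chebyshev.S ℝ n).eval Real.goldenRatio * Real.sin (Real.pi / 5) = Real.sin ((n + 1) * (Real.pi / 5)) := by
  rw [← two_mul_cos_pi_div_five_eq_goldenRatio, Polynomial.Chebyshev.S_two_mul_real_cos]

/-- **`2cos(2π∕5) = −ψ = φ − 1`, `2cos(3π∕5) = ψ = 1 − φ`, `2cos(4π∕5) = −φ`** (the ring-general values `C_2(x) = x − 1`, `C_3(x) = 1 − x`, `C_4(x) = −x` at `x = φ`; the `k = 2` entry is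
`Literature…GoldenCyclotomicArithmetic.cos_two_pi_div_five_eq` in another form). [Hobson 1928, §§60–61; Koshy 2001, Ch. 17; this file, §1289] -/
theorem two_mul_cos_mul_pi_div_five :
    2 * Real.cos (2 * (Real.pi / 5)) = -Real.goldenConj ∧ 2 * Real.cos (3 * (Real.pi / 5)) = Real.goldenConj ∧ 2 * Real.cos (4 * (Real.pi / 5)) = -Real.goldenRatio := by
  obtain ⟨h2, h3, h4, -⟩ := chebyshevC_eval_of_sq_eq_self_add_one (R := ℝ) Real.goldenRatio_sq
  have e2 := chebyshevC_eval_goldenRatio 2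
  have e3 := chebyshevC_eval_goldenRatio 3
  have e4 := chebyshevC_eval_goldenRatio 4
  push_cast at e2 e3 e4
  refine ⟨?_, ?_, ?_⟩
  · rw [← e2, h2, ← Real.one_sub_goldenConj]
    ring
  · rw [← e3, h3, Real.one_sub_goldenConj]
  · rw [← e4, h4]

/-! ### Root multisets over `ℝ` -/

/-- `X² − X − 1 = (X − φ)(X − ψ)` over `ℝ` (`φ + ψ = 1`, `φψ = −1`). [this file, §1289] -/
theorem X_sq_sub_X_sub_one_eq_mul : (X ^ 2 - X - 1 : ℝ[X]) = (X - Polynomial.C Real.goldenRatio) * (X - Polynomial.C Real.goldenConj) := by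
  have h : (X - Polynomial.C Real.goldenRatio) * (X - Polynomial.C Real.goldenConj) =
      X ^ 2 - Polynomial.C (Real.goldenRatio + Real.goldenConj) * X + Polynomial.C (Real.goldenRatio * Real.goldenConj) := by
    rw [Polynomial.C_add, Polynomial.C_mul]
    ring
  rw [h, Real.goldenRatio_add_goldenConj, Real.goldenRatio_mul_goldenConj, Polynomial.C_neg, Polynomial.C_1]
  ring

/-- `X² + X − 1 = (X + φ)(X + ψ)` over `ℝ`. [this file, §1289] -/
theorem X_sq_add_X_sub_one_eq_mul : (X ^ 2 + X - 1 : ℝ[X]) = (X + Polynomial.C Real.goldenRatio) * (X + Polynomial.C Real.goldenConj) := by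
  have h : (X + Polynomial.C Real.goldenRatio) * (X + Polynomial.C Real.goldenConj) =
      X ^ 2 + Polynomial.C (Real.goldenRatio + Real.goldenConj) * X + Polynomial.C (Real.goldenRatio * Real.goldenConj) := by
    rw [Polynomial.C_add, Polynomial.C_mul]
    ring
  rw [h, Real.goldenRatio_add_goldenConj, Real.goldenRatio_mul_goldenConj, Polynomial.C_neg, Polynomial.C_1]
  ring

/-- **`(S_4 over ℝ).roots = {φ, ψ, −φ, −ψ}`** (`S_4 = (X² − X − 1)(X² + X − 1)`; the roots `2cos(kπ∕5)`, `k = 1, …, 4`, of N500 in golden form). [Koshy 2001, Ch. 17; this file, §1289] -/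
theorem chebyshevS_four_roots_real : (Polynomial.Chebyshev.S ℝ 4).roots = {Real.goldenRatio, Real.goldenConj, -Real.goldenRatio, -Real.goldenConj} := by
  have h : Polynomial.Chebyshev.S ℝ 4 = (({Real.goldenRatio, Real.goldenConj, -Real.goldenRatio, -Real.goldenConj} : Multiset ℝ).map fun a => X - Polynomial.C a).prod := by
    simp only [Multiset.insert_eq_cons, Multiset.map_cons, Multiset.map_singleton, Multiset.prod_cons, Multiset.prod_singleton]
    rw [chebyshevS_four_eq_mul, X_sq_sub_X_sub_one_eq_mul, X_sq_add_X_sub_one_eq_mul, Polynomial.C_neg, Polynomial.C_neg]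
    ring
  rw [h, Polynomial.roots_multiset_prod_X_sub_C]

/-- **`(C_5 + 2 over ℝ).roots = {−2, φ, ψ, φ, ψ}`** (`φ`, `ψ` are double roots: `C_5 + 2 = (X + 2)(X − φ)²(X − ψ)²`). [Koshy 2001, Ch. 17; this file, §1289] -/
theorem chebyshevC_five_add_two_roots_real :
    (Polynomial.Chebyshev.C ℝ 5 + 2).roots = {-2, Real.goldenRatio, Real.goldenConj, Real.goldenRatio, Real.goldenConj} := by
  have h : Polynomial.Chebyshev.C ℝ 5 + 2 = (({-2, Real.goldenRatio, Real.goldenConj, Real.goldenRatio, Real.goldenConj} : Multiset ℝ).map fun a => X - Polynomial.C a).prod := by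
    simp only [Multiset.insert_eq_cons, Multiset.map_cons, Multiset.map_singleton, Multiset.prod_cons, Multiset.prod_singleton]
    rw [chebyshevC_five_add_two, show (X ^ 2 - X - 1 : ℝ[X]) ^ 2 = (X ^ 2 - X - 1) * (X ^ 2 - X - 1) from sq _, X_sq_sub_X_sub_one_eq_mul, Polynomial.C_neg, Polynomial.C_ofNat]
    ring
  rw [h, Polynomial.roots_multiset_prod_X_sub_C]

/-- **`(C_5 − 2 over ℝ).roots = {2, −φ, −ψ, −φ, −ψ}`** (`C_5 − 2 = (X − 2)(X + φ)²(X + ψ)²`). [Koshy 2001, Ch. 17; this file, §1289] -/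
theorem chebyshevC_five_sub_two_roots_real :
    (Polynomial.Chebyshev.C ℝ 5 - 2).roots = {2, -Real.goldenRatio, -Real.goldenConj, -Real.goldenRatio, -Real.goldenConj} := by
  have h : Polynomial.Chebyshev.C ℝ 5 - 2 = (({2, -Real.goldenRatio, -Real.goldenConj, -Real.goldenRatio, -Real.goldenConj} : Multiset ℝ).map fun a => X - Polynomial.C a).prod := by
    simp only [Multiset.insert_eq_cons, Multiset.map_cons, Multiset.map_singleton, Multiset.prod_cons, Multiset.prod_singleton]
    rw [chebyshevC_five_sub_two, show (X ^ 2 + X - 1 : ℝ[X]) ^ 2 = (X ^ 2 + X - 1) * (X ^ 2 + X - 1) from sq _, X_sq_add_X_sub_one_eq_mul, Polynomial.C_neg, Polynomial.C_neg,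
      Polynomial.C_ofNat]
    ring
  rw [h, Polynomial.roots_multiset_prod_X_sub_C]

end Summit.Ventures.HSemireg.Wedge.HankelOuter
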